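import Summits.Parity.GeneralizedHardyLittlewood.Theses.EntropyRate

/-!
# Birth skeleton (BC3) — crux stmt-Parity-17876 `Theses.EntropyRate.UniformEntropyRate` (rank 2, THE DOOR)
# line `birth`: CONVERGENCE of the natural-scale block-entropy rate of λ ∧ ASYMPTOTIC SUBADDITIVITY
# of the rate ⟹ the door, by harmonic pigeonhole along the chain `M_j = k^j · M₀`

Registered by the skeleton registrar (planner one-shot `planner-skel-stmt-Parity-17876-0`, 2026-08-17;
BC3 of `run/shared/lean/lens3/_common/BC.md`). Route `route-Parity-EntropyRate`. Two NAMED stubs and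
the kernel-checked composition `UniformEntropyRate_of` concluding the crux BY NAME;
`UniformEntropyRate_of_stubs` plugs the stubs in. This is the decomposition the route header itself
announces (TWO-LAYER PLAN: "UniformEntropyRate ⇐ BlockEntropyConverges → RateAntitone →
UniformEntropyRate … pigeonhole along M_j = k^j·M₀ with Σ_j ε/(2 log M_j) = ∞"), with the
antitonicity hypothesis replaced by its honest finite-X form (asymptotic subadditivity, a PROVABLE
statement that presupposes no limits).

## The crux (FIXED; verbatim the route decl, read through `rate`)

`h_X(M) := ent_X(M) / M`, `ent_X(M) = Σ_{w : Fin M → Bool} negMulLog (freq_X(M, w))`,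
`freq_X(M, w) = #{n < X : ∀ j < M, λ(n+1+j) = 1 ↔ w j} / X` (the empirical law of the Liouville sign
word of length `M`, `n` uniform in `[0, X)`). Door: `∀ ε > 0, ∀ k ≥ 2, ∀ H₁, ∃ H ≥ max(H₁, 2), ∃ X₀,
∀ X ≥ X₀: h_X(H) − h_X(kH) ≤ ε / log H`. (`uniformEntropyRate_iff_rate` below is `Iff.rfl`.)

## The cut

* `stub_blockEntropyConverges` (OPEN — the load-bearing stub): for every `M ≥ 1` the rate `h_X(M)`
  CONVERGES as `X → ∞` (to some `r(M)`; necessarily `r(M) ∈ [0, log 2]`). Equivalently: the Shannon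
  entropy of the empirical law of the length-`M` sign pattern of λ at natural scale has a limit. Implied
  by natural-density Chowla (every pattern has density `2^{-M}`, `r ≡ log 2`); for `M = 2` it is
  already EQUIVALENT to natural-density binary Chowla at shift 1 (the law of `(λ(n+1), λ(n+2))` is
  `(1 ± c_X)/4` up to `o(1)` with `c_X = X⁻¹ Σ_{n<X} λ(n+1)λ(n+2)`, its entropy is an even strictly
  decreasing function of `|c_X|`, and Tao–Teräväinen's almost-all-scales theorem forces any limit of
  `|c_X|` to be `0`) — so the stub is Chowla-strength in its first instance and strictly stronger than
  the door; it is the natural "limit exists" statement (existence of the natural-scale Furstenberg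
  entropy of λ per block length), NOT a restatement of the crux or of the summit (BC3 probes fail).
* `stub_rateAsympSubadditive` (PROVABLE, M/L): for `k, M ≥ 1` and `δ > 0`, eventually in `X`,
  `h_X(kM) ≤ h_X(M) + δ`. Proof on paper: Shannon subadditivity `H(W₀,…,W_{k−1}) ≤ Σ_i H(W_i)` for the
  `k` consecutive length-`M` blocks of the `kM`-word under the empirical measure; the law of block `i`
  is the length-`M` law computed over `n ∈ [iM, X + iM)`, within total variation `2iM/X` of
  `freq_X(M, ·)`; entropy is uniformly continuous on the finite simplex. (Translation invariance only —
  the same input as Tao's relative subadditivity, arXiv:1509.05422 Lemma 2.5 / §3.) In Lean this needs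
  Shannon entropy of a pushforward/marginal on `Fin (kM) → Bool` and its subadditivity over a product
  decomposition — not in Mathlib as a packaged fact; genuine work, no open content.

Composition `UniformEntropyRate_of` (REAL proof, this file): fix `ε, k ≥ 2, H₁`; `M₀ := max H₁ 2`,
`M_j := k^j M₀`; `r_j := lim_X h_X(M_j)` (stub 1); `0 ≤ r_j` (entropy of frequencies in `[0,1]` is
`≥ 0`, proved here) and `r_{j+1} ≤ r_j` (stub 2 + limits); if `ε / log M_j ≤ r_j − r_{j+1}` held for
EVERY `j`, then with `log M_j ≤ (j+1) log (k M₀)` summing gives `(ε / log(kM₀)) Σ_{j<n} 1/(j+1) ≤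
r_0 − r_n ≤ r_0` for all `n`, contradicting the divergence of the harmonic series
(`Real.tendsto_sum_range_one_div_nat_succ_atTop`); so some `j` has `r_j − r_{j+1} < ε / log M_j`, and
since `h_X(M_j) − h_X(k M_j) → r_j − r_{j+1}`, eventually `h_X(H) − h_X(kH) ≤ ε / log H` with
`H := M_j ≥ M₀ ≥ max(H₁, 2)`.

Remark for the lead / tenure planner (refuter caveat, `CruxAttackGen1.md`): the consumer
`EntropyTransfer` wants the dilation `k` to grow like `log H`; the SAME two stubs give the re-typed
door `UniformEntropyRateLogK` (k_H = ⌈(log H)²⌉) by the same pigeonhole along the faster chain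
`M_{j+1} = k_{M_j} M_j` (`Σ 1/log M_j ≍ Σ 1/(j log j) = ∞`); only the composition changes. So this
skeleton survives the suggested re-typing unchanged in its stubs.

Disproof.lean: none exists for this crux at registration (`ledger crux ls stmt-Parity-17876`: only
`CruxAttackGen1.{lean,md}`) — no `_false_without_` obligations; negatives index: nothing on entropy.
-/

set_option linter.dupNamespace false

noncomputable section

open scoped BigOperators Topology
open Filter

namespace Summit.Parity.GeneralizedHardyLittlewood.Cruxes.UniformEntropyRate.Birth

open Summit.Parity.GeneralizedHardyLittlewood.Theses.EntropyRate (UniformEntropyRate)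

/-! ## Vocabulary (the `let`s of the route decl, named) -/

/-- Empirical frequency, at scale `X`, of the sign word `w` of length `M`:
`#{n < X : ∀ j < M, λ(n+1+j) = 1 ↔ w j} / X` (the route decl's `freq`, with `X` explicit). -/
def freq (X M : ℕ) (w : Fin M → Bool) : ℝ :=
  ((((Finset.range X).filter (fun n : ℕ => ∀ j : Fin M,
      (ArithmeticFunction.liouville (n + 1 + (j : ℕ)) = 1 ↔ w j = true))).card : ℕ) : ℝ) / X

/-- Empirical block entropy (nats) of the length-`M` Liouville sign word at scale `X`
(the route decl's `ent`; identical to the refuter's `blockEnt` of `CruxAttackGen1.lean`). -/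
def blockEnt (X M : ℕ) : ℝ :=
  ∑ w : Fin M → Bool, Real.negMulLog (freq X M w)

/-- Per-symbol entropy rate `h_X(M) = ent_X(M) / M`. -/
def rate (X M : ℕ) : ℝ :=
  blockEnt X M / (M : ℝ)

/-- The route decl read through `rate` (definitional: `let`-zeta + unfolding). -/
theorem uniformEntropyRate_iff_rate :
    UniformEntropyRate ↔
      ∀ ε : ℝ, 0 < ε → ∀ k : ℕ, 2 ≤ k → ∀ H₁ : ℕ, ∃ H : ℕ, H₁ ≤ H ∧ 2 ≤ H ∧ ∃ X₀ : ℕ, ∀ X : ℕ,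
        X₀ ≤ X → rate X H - rate X (k * H) ≤ ε / Real.log H :=
  Iff.rfl

/-! ## Registered stub signatures (named, so that the hypotheses of `UniformEntropyRate_of` are the
declared stubs BY NAME for `#h21_check_skeleton`; each `theorem stub_<name>` states the same text) -/

/-- Signature of `stub_blockEntropyConverges`: the natural-scale block-entropy rate of λ converges,
for every block length `M ≥ 1`. -/
def Sig.stub_blockEntropyConverges : Prop :=
  ∀ M : ℕ, 1 ≤ M → ∃ r : ℝ, Tendsto (fun X : ℕ => rate X M) atTop (𝓝 r)

/-- Signature of `stub_rateAsympSubadditive`: asymptotic subadditivity of the rate under dilation of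
the block length, `h_X(kM) ≤ h_X(M) + δ` for `X ≥ X₀(k, M, δ)`. -/
def Sig.stub_rateAsympSubadditive : Prop :=
  ∀ k M : ℕ, 1 ≤ k → 1 ≤ M → ∀ δ : ℝ, 0 < δ → ∃ X₀ : ℕ, ∀ X : ℕ, X₀ ≤ X →
    rate X (k * M) ≤ rate X M + δ

/-! ## The stubs (`sorry` only here) -/

/-- **Stub 1 (OPEN; the load-bearing stub). BLOCK-ENTROPY CONVERGENCE at natural scale:** for every
`M ≥ 1` the per-symbol Shannon entropy `h_X(M)` of the empirical law of the Liouville sign word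
`(λ(n+1),…,λ(n+M))`, `n` uniform in `[0,X)`, converges as `X → ∞`. Implied by natural-density Chowla
(`h_X(M) → log 2`); for `M = 2` equivalent to natural-density Chowla at shift 1 given Tao–Teräväinen's
almost-all-scales theorem; open. Why it might fail: a "diagonal conspiracy" of λ at natural scales
(oscillation of pattern statistics between scales `x` and `px`) is consistent with every logarithmically
averaged theorem (Tao 2016 p. 9); Sarnak's positive-entropy question for the Liouville Furstenberg
systems is open even logarithmically. [cite: arXiv:1509.05422 §3; arXiv:1809.02518 Thm 1.17, §5;
arXiv:2007.15644 Thm 1.9; arXiv:1804.08556] Size: open-problem. -/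
theorem stub_blockEntropyConverges :
    ∀ M : ℕ, 1 ≤ M → ∃ r : ℝ, Tendsto (fun X : ℕ => rate X M) atTop (𝓝 r) := by
  sorry

/-- **Stub 2 (PROVABLE, M/L). ASYMPTOTIC SUBADDITIVITY of the rate:** for `k, M ≥ 1` and `δ > 0`
there is `X₀` with `h_X(kM) ≤ h_X(M) + δ` for all `X ≥ X₀`. Paper proof: Shannon subadditivity of the
joint entropy of the `k` consecutive length-`M` blocks of the `kM`-word under the empirical measure on
`n ∈ [0,X)`, the law of block `i` being within total variation `2iM/X` of `freq_X(M,·)` (translation),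
and uniform continuity of `p ↦ Σ negMulLog (p w)` on the simplex over `Fin M → Bool`.
[cite: arXiv:1509.05422 Lemma 2.5 (relative subadditivity, q = 1); CoverThomas2006 Thm 2.6.6]
Size: M/L (Shannon entropy of finite laws + subadditivity are not packaged in Mathlib). -/
theorem stub_rateAsympSubadditive :
    ∀ k M : ℕ, 1 ≤ k → 1 ≤ M → ∀ δ : ℝ, 0 < δ → ∃ X₀ : ℕ, ∀ X : ℕ, X₀ ≤ X →
      rate X (k * M) ≤ rate X M + δ := by
  sorry

/-! ## Sorry-free facts used by the composition -/

theorem freq_nonneg (X M : ℕ) (w : Fin M → Bool) : 0 ≤ freq X M w := by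
  unfold freq
  positivity

theorem freq_le_one (X M : ℕ) (w : Fin M → Bool) : freq X M w ≤ 1 := by
  unfold freq
  rcases Nat.eq_zero_or_pos X with hX | hX
  · subst hX
    simp
  · rw [div_le_one (by exact_mod_cast hX)]
    exact_mod_cast (Finset.card_filter_le _ _).trans (Finset.card_range X).le

theorem blockEnt_nonneg (X M : ℕ) : 0 ≤ blockEnt X M :=
  Finset.sum_nonneg fun w _ => Real.negMulLog_nonneg (freq_nonneg X M w) (freq_le_one X M w)

theorem rate_nonneg (X M : ℕ) : 0 ≤ rate X M :=
  div_nonneg (blockEnt_nonneg X M) (Nat.cast_nonneg M)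

/-- **Harmonic pigeonhole.** A sequence `r : ℕ → ℝ` that is bounded below by `0` cannot drop by at
least `ε / ((j+1) C)` at EVERY step `j` (`ε, C > 0`): the harmonic series diverges. -/
theorem exists_small_drop (r : ℕ → ℝ) (hr0 : ∀ j, 0 ≤ r j) {ε C : ℝ} (hε : 0 < ε) (hC : 0 < C) :
    ∃ j : ℕ, r j - r (j + 1) < ε / (((j : ℝ) + 1) * C) := by
  by_contra hcon
  simp only [not_exists, not_lt] at hcon
  -- hcon : ∀ j, ε / ((↑j + 1) * C) ≤ r j - r (j + 1)
  have hsum : ∀ n : ℕ, ε / C * ∑ i ∈ Finset.range n, (1 / ((i : ℝ) + 1)) ≤ r 0 := by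
    intro n
    calc ε / C * ∑ i ∈ Finset.range n, (1 / ((i : ℝ) + 1))
        = ∑ i ∈ Finset.range n, ε / C * (1 / ((i : ℝ) + 1)) := Finset.mul_sum _ _ _
      _ = ∑ i ∈ Finset.range n, ε / (((i : ℝ) + 1) * C) := by
          refine Finset.sum_congr rfl fun i _ => ?_
          rw [div_mul_div_comm, mul_one, mul_comm C]
      _ ≤ ∑ i ∈ Finset.range n, (r i - r (i + 1)) := Finset.sum_le_sum fun i _ => hcon i
      _ = r 0 - r n := Finset.sum_range_sub' r n
      _ ≤ r 0 := by linarith [hr0 n]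
  have hdiv : Tendsto (fun n : ℕ => ε / C * ∑ i ∈ Finset.range n, (1 / ((i : ℝ) + 1))) atTop atTop :=
    (Real.tendsto_sum_range_one_div_nat_succ_atTop).const_mul_atTop (div_pos hε hC)
  obtain ⟨n, hn⟩ := (Filter.tendsto_atTop.mp hdiv (r 0 + 1)).exists
  linarith [hsum n]

/-! ## Composition: the crux BY NAME from the two stubs (real proof, no `sorry`) -/

/-- **UniformEntropyRate from block-entropy convergence and asymptotic subadditivity.** Harmonic
pigeonhole along the chain `M_j = k^j · max(H₁, 2)`: the limits `r_j` are `≥ 0` and non-increasing, so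
some step has `r_j − r_{j+1} < ε / log M_j` (else `(ε / log(k M₀)) Σ 1/(j+1) ≤ r_0`); at that `H = M_j`
the difference `h_X(H) − h_X(kH)` tends to `r_j − r_{j+1}` and is eventually `≤ ε / log H`. -/
theorem UniformEntropyRate_of :
    Sig.stub_blockEntropyConverges → Sig.stub_rateAsympSubadditive → UniformEntropyRate := by
  intro hconv hsub
  rw [uniformEntropyRate_iff_rate]
  intro ε hε k hk H₁
  -- the base of the chain
  obtain ⟨M₀, hM₀H, hM₀2⟩ : ∃ M₀ : ℕ, H₁ ≤ M₀ ∧ 2 ≤ M₀ := ⟨max H₁ 2, le_max_left _ _, le_max_right _ _⟩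
  have hk1 : 1 ≤ k := le_trans (by norm_num) hk
  have hkpos : 0 < k := hk1
  -- the chain `M j = k^j * M₀`, kept opaque
  obtain ⟨M, hM⟩ : ∃ M : ℕ → ℕ, ∀ j, M j = k ^ j * M₀ := ⟨fun j => k ^ j * M₀, fun _ => rfl⟩
  have hMsucc : ∀ j, M (j + 1) = k * M j := by
    intro j
    rw [hM, hM, pow_succ]
    ring
  have hMge : ∀ j, M₀ ≤ M j := by
    intro j
    rw [hM]
    exact Nat.le_mul_of_pos_left M₀ (pow_pos hkpos j)
  have hM2 : ∀ j, 2 ≤ M j := fun j => hM₀2.trans (hMge j)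
  have hM1 : ∀ j, 1 ≤ M j := fun j => le_trans (by norm_num) (hM2 j)
  -- limits along the chain (stub 1)
  choose r hr using fun j => hconv (M j) (hM1 j)
  have hr' : ∀ j, Tendsto (fun X : ℕ => rate X (k * M j)) atTop (𝓝 (r (j + 1))) := by
    intro j
    simpa only [hMsucc] using hr (j + 1)
  -- the limits are `≥ 0` and non-increasing (stub 2)
  have hr0 : ∀ j, 0 ≤ r j := fun j => ge_of_tendsto' (hr j) fun X => rate_nonneg X (M j)
  have hanti : ∀ j, r (j + 1) ≤ r j := by
    intro j
    refine le_of_forall_pos_le_add fun δ hδ => ?_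
    obtain ⟨X₀, hX₀⟩ := hsub k (M j) hk1 (hM1 j) δ hδ
    exact le_of_tendsto_of_tendsto (hr' j) ((hr j).add_const δ)
      (Filter.eventually_atTop.mpr ⟨X₀, hX₀⟩)
  -- `0 < log (M j) ≤ (j + 1) * log (k * M₀)`
  have hlogpos : ∀ j, 0 < Real.log (M j) := fun j =>
    Real.log_pos (by exact_mod_cast (lt_of_lt_of_le (by norm_num) (hM2 j) : 1 < M j))
  have hC : 0 < Real.log ((k * M₀ : ℕ) : ℝ) := by
    apply Real.log_pos
    have h4 : 2 * 2 ≤ k * M₀ := Nat.mul_le_mul hk hM₀2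
    exact_mod_cast (lt_of_lt_of_le (by norm_num) h4 : 1 < k * M₀)
  have hlogle : ∀ j, Real.log (M j) ≤ ((j : ℝ) + 1) * Real.log ((k * M₀ : ℕ) : ℝ) := by
    intro j
    have hnat : M j ≤ (k * M₀) ^ (j + 1) := by
      rw [hM, mul_pow]
      exact Nat.mul_le_mul (Nat.pow_le_pow_right hkpos (Nat.le_succ j))
        (le_self_pow₀ (le_trans (by norm_num) hM₀2) (Nat.succ_ne_zero j))
    have hreal : (M j : ℝ) ≤ ((k * M₀ : ℕ) : ℝ) ^ (j + 1) := by exact_mod_cast hnat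
    have hpos : (0 : ℝ) < (M j : ℝ) := by exact_mod_cast (lt_of_lt_of_le (by norm_num) (hM2 j) : 0 < M j)
    calc Real.log (M j) ≤ Real.log (((k * M₀ : ℕ) : ℝ) ^ (j + 1)) := Real.log_le_log hpos hreal
      _ = ((j + 1 : ℕ) : ℝ) * Real.log ((k * M₀ : ℕ) : ℝ) := Real.log_pow _ _
      _ = ((j : ℝ) + 1) * Real.log ((k * M₀ : ℕ) : ℝ) := by push_cast; ring
  -- harmonic pigeonhole: some step of the chain has a small entropy-rate decrement in the limit
  obtain ⟨j, hj⟩ := exists_small_drop r hr0 hε hC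
  have hj' : r j - r (j + 1) < ε / Real.log (M j) :=
    lt_of_lt_of_le hj (div_le_div_of_nonneg_left hε.le (hlogpos j) (hlogle j))
  -- pass to finite `X` at `H := M j`
  have hT : Tendsto (fun X : ℕ => rate X (M j) - rate X (k * M j)) atTop (𝓝 (r j - r (j + 1))) :=
    (hr j).sub (hr' j)
  obtain ⟨X₀, hX₀⟩ := Filter.eventually_atTop.mp (hT.eventually (gt_mem_nhds hj'))
  exact ⟨M j, hM₀H.trans (hMge j), hM2 j, X₀, fun X hX => (hX₀ X hX).le⟩

/-- The skeleton instantiated: the crux BY NAME modulo the two registered stubs (carries their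
`sorry`s, nothing else). -/
theorem UniformEntropyRate_of_stubs : UniformEntropyRate :=
  UniformEntropyRate_of stub_blockEntropyConverges stub_rateAsympSubadditive

end Summit.Parity.GeneralizedHardyLittlewood.Cruxes.UniformEntropyRate.Birth

end
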